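import Literature.Barriers.RiemannHypothesis.JensenPolynomialsSqrtMixedWitness
import HarnessLib

/-!
# The barrier `JensenPolynomialsSqrtMixed`: a genus-zero witness with `G' ∈ L–P`, INFINITELY MANY REAL zeros
# AND infinitely many non-real zeros — the scope caveat of `JensenPolynomialsSqrt` made a theorem

Part 2 of the formalisation of the example `cos z + 2 cos (z/20)` named in the `scope_caveats` of
`Literature.Barriers.RiemannHypothesis.JensenPolynomialsSqrt` (Farmer 2022 §4), in the `√`-normalisation
`M(w) = cosh √w + 2 cosh (√w/20)` (`coshSqrtMix`, part 1 = `JensenPolynomialsSqrtMixedWitness.lean`).  Source: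
cell rh-split, seat rh-split-jen-bridge gen 3 (`SketchG3.lean` §7, sha16 56ebb7b3456d0835, standard axioms); filed
by rh-split-typer-1 g3 (referee g2 content PASS 2026-08-27T01:19:41Z).

Contents: infinitely many NON-REAL zeros `u_m²`, `u_m = -y₀ + 40(2m+1)·(π/2)·i… = -y₀ + 2(10(2m+1))π i` with
`cosh y₀ = 2 cosh (y₀/20)`, `y₀ ∈ (0,4]` (`coshSqrtMix_nonreal_zeros_infinite`); infinitely many REAL zeros
`-(y_j²)`, one `y_j` in each `[40jπ, (40j+20)π]` (`coshSqrtMix_real_zeros_infinite`); all zeros are `u²` with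
`|Re u| ≤ 2` (`exists_sq_eq_abs_re_le_of_coshSqrtMix_eq_zero`); every `J^{d,n}(M)` with `n ≥ 1` hyperbolic and
`EventuallyHyperbolic` (`M'` genus-zero Laguerre–Pólya, part 1), yet some `J^{d,0}(M)` is NOT hyperbolic
(Pólya–Schur converse at a non-real zero) so `¬ AllHyperbolic`; packaged as the Prop `JensenPolynomialsSqrtMixed`
with `JensenPolynomialsSqrtMixed_holds`.  Compared with `JensenPolynomialsSqrt` (witness `cosh 2 + cosh √w`, NO
real zero), the new clause is `{w | G w = 0 ∧ Im w = 0}.Infinite`: the shift-`≥ 1` information plus the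
unconditional structure of `xiSq` does not even force the real and non-real zeros to separate into «all» and
«none».

HONEST LABEL (cell rh-split): «SPLITTING SEARCH over kernel-typed RH-EQUIVALENCES; nothing here bears on
the truth of RH.»
-/

noncomputable section

open Complex Polynomial Filter Topology
open scoped Nat Real ComplexConjugate

namespace Literature.Barriers.RiemannHypothesis

open Literature.NumberTheory.LFunctions (jensenPoly exists_sq_eq iteratedDeriv_conj_of_conj)
open Literature.Analysis.TotalPositivity (IsEntireOfOrderLtOne)

namespace CoshSqrtMix

/-! ### Infinitely many NON-REAL zeros: `u_m = -y₀ + 20(2m+1)π·i`, `cosh y₀ = 2 cosh (y₀/20)` -/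

/-- There is `y₀ ∈ (0, 4]` with `cosh y₀ = 2 cosh (y₀ / 20)` (intermediate value theorem). [folklore] -/
private theorem exists_cosh_eq_two_mul_cosh_div :
    ∃ y : ℝ, 0 < y ∧ y ≤ 4 ∧ Real.cosh y = 2 * Real.cosh (y / 20) := by
  let g : ℝ → ℝ := fun y ↦ Real.cosh y - 2 * Real.cosh (y / 20)
  have hg : ContinuousOn g (Set.Icc 0 4) := by
    apply Continuous.continuousOn; unfold g; fun_prop
  have h0 : g 0 = -1 := by simp [g]; norm_num
  have h4 : 0 ≤ g 4 := by
    have e4 : (13 : ℝ) ≤ Real.exp 4 := by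
      have := Real.quadratic_le_exp_of_nonneg (show (0 : ℝ) ≤ 4 by norm_num); nlinarith
    have c4 : (13 : ℝ) / 2 ≤ Real.cosh 4 := by
      rw [Real.cosh_eq]; have := Real.exp_pos (-4); linarith
    have c5 : Real.cosh (4 / 20) ≤ Real.exp 1 := by
      rw [Real.cosh_eq]
      have h1 : Real.exp (4 / 20) ≤ Real.exp 1 := Real.exp_le_exp.2 (by norm_num)
      have h2 : Real.exp (-(4 / 20)) ≤ Real.exp 1 := Real.exp_le_exp.2 (by norm_num)
      linarith
    have := Real.exp_one_lt_d9
    show 0 ≤ Real.cosh 4 - 2 * Real.cosh (4 / 20)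
    nlinarith
  have hmem : (0 : ℝ) ∈ Set.Icc (g 0) (g 4) := ⟨by rw [h0]; norm_num, h4⟩
  obtain ⟨y, ⟨hy0, hy4⟩, hy⟩ := intermediate_value_Icc (by norm_num : (0 : ℝ) ≤ 4) hg hmem
  have hy0' : y ≠ 0 := by rintro rfl; rw [h0] at hy; norm_num at hy
  refine ⟨y, lt_of_le_of_ne hy0 (Ne.symm hy0'), hy4, ?_⟩
  have : Real.cosh y - 2 * Real.cosh (y / 20) = 0 := hy
  linarith

/-- `y₀`: the imaginary offset of the non-real zeros. [folklore] -/
private def yZero : ℝ := Classical.choose exists_cosh_eq_two_mul_cosh_div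

/-- `0 < y₀`. [folklore] -/
private theorem yZero_pos : 0 < yZero := (Classical.choose_spec exists_cosh_eq_two_mul_cosh_div).1

/-- `y₀ ≤ 4`. [folklore] -/
private theorem yZero_le : yZero ≤ 4 := (Classical.choose_spec exists_cosh_eq_two_mul_cosh_div).2.1

/-- `cosh y₀ = 2 cosh (y₀/20)`. [folklore] -/
private theorem cosh_yZero : Real.cosh yZero = 2 * Real.cosh (yZero / 20) :=
  (Classical.choose_spec exists_cosh_eq_two_mul_cosh_div).2.2

/-- The angle `θ_m = 20(2m+1)π`, written `(2·(10(2m+1)))·π`. [folklore] -/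
private def thetaSeq (m : ℕ) : ℝ := ((2 * (10 * (2 * m + 1)) : ℕ) : ℝ) * Real.pi

/-- `cos θ_m = 1`. [folklore] -/
private theorem cos_thetaSeq (m : ℕ) : Real.cos (thetaSeq m) = 1 := by
  rw [thetaSeq, Real.cos_nat_mul_pi, pow_mul, neg_one_sq, one_pow]

/-- `sin θ_m = 0`. [folklore] -/
private theorem sin_thetaSeq (m : ℕ) : Real.sin (thetaSeq m) = 0 := by
  rw [thetaSeq, Real.sin_nat_mul_pi]

/-- `θ_m/20 = (2m+1)π`. [folklore] -/
private theorem thetaSeq_div (m : ℕ) : thetaSeq m / 20 = ((2 * m + 1 : ℕ) : ℝ) * Real.pi := by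
  rw [thetaSeq]; push_cast; ring

/-- `cos (θ_m/20) = -1`. [folklore] -/
private theorem cos_thetaSeq_div (m : ℕ) : Real.cos (thetaSeq m / 20) = -1 := by
  rw [thetaSeq_div, Real.cos_nat_mul_pi, pow_succ, pow_mul, neg_one_sq, one_pow, one_mul]

/-- `sin (θ_m/20) = 0`. [folklore] -/
private theorem sin_thetaSeq_div (m : ℕ) : Real.sin (thetaSeq m / 20) = 0 := by
  rw [thetaSeq_div, Real.sin_nat_mul_pi]

/-- `0 < θ_m`. [folklore] -/
private theorem thetaSeq_pos (m : ℕ) : 0 < thetaSeq m := by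
  rw [thetaSeq]; positivity

/-- `u_m = -y₀ + θ_m i`. [folklore] -/
private def uSeq (m : ℕ) : ℂ := ((-yZero : ℝ) : ℂ) + (thetaSeq m : ℂ) * I

/-- `cosh u_m = cosh y₀`. [folklore] -/
private theorem cosh_uSeq (m : ℕ) : Complex.cosh (uSeq m) = (Real.cosh yZero : ℂ) := by
  rw [uSeq, Complex.cosh_add, Complex.cosh_mul_I, Complex.sinh_mul_I, ← Complex.ofReal_cos,
    ← Complex.ofReal_sin, cos_thetaSeq, sin_thetaSeq, ← Complex.ofReal_cosh, Real.cosh_neg]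
  simp

/-- `cosh (u_m/20) = -cosh (y₀/20)`. [folklore] -/
private theorem cosh_uSeq_div (m : ℕ) : Complex.cosh (uSeq m / 20) = -(Real.cosh (yZero / 20) : ℂ) := by
  rw [uSeq, show (((-yZero : ℝ) : ℂ) + (thetaSeq m : ℂ) * I) / 20 =
      ((-(yZero / 20) : ℝ) : ℂ) + ((thetaSeq m / 20 : ℝ) : ℂ) * I by push_cast; ring,
    Complex.cosh_add, Complex.cosh_mul_I, Complex.sinh_mul_I, ← Complex.ofReal_cos, ← Complex.ofReal_sin,
    cos_thetaSeq_div, sin_thetaSeq_div, ← Complex.ofReal_cosh, Real.cosh_neg]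
  simp

/-- `M(u_m²) = cosh y₀ - 2 cosh (y₀/20) = 0`. [folklore] -/
private theorem coshSqrtMix_uSeq_sq (m : ℕ) : coshSqrtMix (uSeq m ^ 2) = 0 := by
  rw [coshSqrtMix_sq, cosh_uSeq, cosh_uSeq_div, cosh_yZero]; push_cast; ring

/-- `Im(u_m²) = -2 y₀ θ_m`. [folklore] -/
private theorem im_uSeq_sq (m : ℕ) : (uSeq m ^ 2).im = -(2 * yZero * thetaSeq m) := by
  rw [uSeq, sq, Complex.mul_im]
  simp
  ring

/-- The zeros `u_m²` are NOT real. [folklore] -/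
private theorem im_uSeq_sq_ne (m : ℕ) : (uSeq m ^ 2).im ≠ 0 := by
  rw [im_uSeq_sq, neg_ne_zero]
  exact (mul_pos (mul_pos two_pos yZero_pos) (thetaSeq_pos m)).ne'

/-- **`M` has infinitely many non-real zeros.** [cite: Farmer2022, §4] -/
theorem coshSqrtMix_nonreal_zeros_infinite : {w : ℂ | coshSqrtMix w = 0 ∧ w.im ≠ 0}.Infinite := by
  refine Set.infinite_of_injective_forall_mem (f := fun m : ℕ ↦ uSeq m ^ 2) (fun j k hjk ↦ ?_)
    fun m ↦ ⟨coshSqrtMix_uSeq_sq m, im_uSeq_sq_ne m⟩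
  have h := congrArg Complex.im hjk
  simp only [im_uSeq_sq, neg_inj, thetaSeq] at h
  have h2 : ((2 * (10 * (2 * j + 1)) : ℕ) : ℝ) = ((2 * (10 * (2 * k + 1)) : ℕ) : ℝ) := by
    have hy := yZero_pos
    have hπ := Real.pi_pos
    have : 2 * yZero * Real.pi ≠ 0 := by positivity
    have h' : 2 * yZero * Real.pi * (((2 * (10 * (2 * j + 1)) : ℕ) : ℝ) - ((2 * (10 * (2 * k + 1)) : ℕ) : ℝ)) = 0 := by
      linear_combination h
    rcases mul_eq_zero.1 h' with h1 | h1
    · exact absurd h1 this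
    · linarith
  have h3 : 2 * (10 * (2 * j + 1)) = 2 * (10 * (2 * k + 1)) := by exact_mod_cast h2
  omega

/-! ### Infinitely many REAL zeros: `-y²` with `cos y + 2 cos (y/20) = 0`, one in each `[40jπ, (40j+20)π]` -/

/-- On the imaginary axis `u = iy`: `M((iy)²) = M(-y²) = cos y + 2 cos (y/20)`. [folklore] -/
private def realAxisFun (y : ℝ) : ℝ := Real.cos y + 2 * Real.cos (y / 20)

/-- `(iy)² = -y²`. [folklore] -/
private theorem ofReal_mul_I_sq (y : ℝ) : ((y : ℂ) * I) ^ 2 = -((y ^ 2 : ℝ) : ℂ) := by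
  rw [mul_pow, I_sq]; push_cast; ring

/-- `M((iy)²) = cos y + 2 cos (y/20)`. [folklore] -/
private theorem coshSqrtMix_mul_I_sq (y : ℝ) : coshSqrtMix (((y : ℂ) * I) ^ 2) = (realAxisFun y : ℂ) := by
  rw [coshSqrtMix_sq, show (y : ℂ) * I / 20 = ((y / 20 : ℝ) : ℂ) * I by push_cast; ring,
    Complex.cosh_mul_I, Complex.cosh_mul_I, ← Complex.ofReal_cos, ← Complex.ofReal_cos, realAxisFun]
  push_cast
  ring

/-- Left endpoints `a_j = 40jπ = (2·(20j))π`: `cos a_j = 1 = cos (a_j/20)`, so the value is `3`. [folklore] -/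
private def aSeq (j : ℕ) : ℝ := ((2 * (20 * j) : ℕ) : ℝ) * Real.pi

/-- `f(a_j) = 3`. [folklore] -/
private theorem realAxisFun_aSeq (j : ℕ) : realAxisFun (aSeq j) = 3 := by
  rw [realAxisFun, aSeq, Real.cos_nat_mul_pi,
    show ((2 * (20 * j) : ℕ) : ℝ) * Real.pi / 20 = ((2 * j : ℕ) : ℝ) * Real.pi by push_cast; ring,
    Real.cos_nat_mul_pi, pow_mul, pow_mul, neg_one_sq, one_pow, one_pow]
  norm_num

/-- Right endpoints `θ_j = (40j+20)π`: the value is `1 - 2 = -1`. [folklore] -/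
private theorem realAxisFun_thetaSeq (j : ℕ) : realAxisFun (thetaSeq j) = -1 := by
  rw [realAxisFun, cos_thetaSeq, cos_thetaSeq_div]; norm_num

/-- `a_j < θ_j`. [folklore] -/
private theorem aSeq_lt_thetaSeq (j : ℕ) : aSeq j < thetaSeq j := by
  rw [aSeq, thetaSeq]
  have : ((2 * (20 * j) : ℕ) : ℝ) < ((2 * (10 * (2 * j + 1)) : ℕ) : ℝ) := by
    exact_mod_cast (by omega : 2 * (20 * j) < 2 * (10 * (2 * j + 1)))
  exact mul_lt_mul_of_pos_right this Real.pi_pos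

/-- `θ_j < a_k` for `j < k`. [folklore] -/
private theorem thetaSeq_lt_aSeq {j k : ℕ} (h : j < k) : thetaSeq j < aSeq k := by
  rw [aSeq, thetaSeq]
  have : ((2 * (10 * (2 * j + 1)) : ℕ) : ℝ) < ((2 * (20 * k) : ℕ) : ℝ) := by
    exact_mod_cast (by omega : 2 * (10 * (2 * j + 1)) < 2 * (20 * k))
  exact mul_lt_mul_of_pos_right this Real.pi_pos

/-- `0 ≤ a_j`. [folklore] -/
private theorem aSeq_nonneg (j : ℕ) : 0 ≤ aSeq j := by rw [aSeq]; positivity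

/-- `f` has a zero in `[a_j, θ_j]` (intermediate value theorem). [folklore] -/
private theorem exists_realAxisFun_eq_zero (j : ℕ) :
    ∃ y : ℝ, aSeq j ≤ y ∧ y ≤ thetaSeq j ∧ realAxisFun y = 0 := by
  have hcont : ContinuousOn realAxisFun (Set.Icc (aSeq j) (thetaSeq j)) := by
    apply Continuous.continuousOn; unfold realAxisFun; fun_prop
  have hmem : (0 : ℝ) ∈ Set.Icc (realAxisFun (thetaSeq j)) (realAxisFun (aSeq j)) := by
    rw [realAxisFun_aSeq, realAxisFun_thetaSeq]; constructor <;> norm_num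
  obtain ⟨y, ⟨h1, h2⟩, hy⟩ := intermediate_value_Icc' (aSeq_lt_thetaSeq j).le hcont hmem
  exact ⟨y, h1, h2, hy⟩

/-- `y_j ∈ [40jπ, (40j+20)π]` with `cos y_j + 2 cos (y_j/20) = 0`. [folklore] -/
private def ySeq (j : ℕ) : ℝ := Classical.choose (exists_realAxisFun_eq_zero j)

/-- `a_j ≤ y_j ≤ θ_j` and `f(y_j) = 0`. [folklore] -/
private theorem ySeq_spec (j : ℕ) : aSeq j ≤ ySeq j ∧ ySeq j ≤ thetaSeq j ∧ realAxisFun (ySeq j) = 0 :=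
  Classical.choose_spec (exists_realAxisFun_eq_zero j)

/-- `0 ≤ y_j`. [folklore] -/
private theorem ySeq_nonneg (j : ℕ) : 0 ≤ ySeq j := (aSeq_nonneg j).trans (ySeq_spec j).1

/-- The `y_j` are pairwise distinct (the intervals `[a_j, θ_j]` are disjoint). [folklore] -/
private theorem ySeq_injective : Function.Injective ySeq := by
  intro j k h
  by_contra hne
  rcases lt_or_gt_of_ne hne with hlt | hlt
  · have h1 := (ySeq_spec j).2.1
    have h2 := (ySeq_spec k).1
    have h3 := thetaSeq_lt_aSeq hlt
    linarith
  · have h1 := (ySeq_spec k).2.1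
    have h2 := (ySeq_spec j).1
    have h3 := thetaSeq_lt_aSeq hlt
    linarith

/-- **`M` has infinitely many real zeros** (`-y_j²`). [cite: Farmer2022, §4] -/
theorem coshSqrtMix_real_zeros_infinite : {w : ℂ | coshSqrtMix w = 0 ∧ w.im = 0}.Infinite := by
  refine Set.infinite_of_injective_forall_mem (f := fun j : ℕ ↦ ((ySeq j : ℂ) * I) ^ 2)
    (fun j k hjk ↦ ?_) fun j ↦ ⟨?_, ?_⟩
  · have h := congrArg Complex.re hjk
    simp only [ofReal_mul_I_sq, Complex.neg_re, Complex.ofReal_re, neg_inj] at h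
    have hy : ySeq j = ySeq k := by
      have hj := ySeq_nonneg j
      have hk := ySeq_nonneg k
      nlinarith
    exact ySeq_injective hy
  · show coshSqrtMix (((ySeq j : ℂ) * I) ^ 2) = 0
    rw [coshSqrtMix_mul_I_sq, (ySeq_spec j).2.2, Complex.ofReal_zero]
  · show ((((ySeq j : ℂ) * I) ^ 2)).im = 0
    rw [ofReal_mul_I_sq, Complex.neg_im, Complex.ofReal_im, neg_zero]

/-! ### All zeros lie in the image of the strip `|Re u| ≤ 2` -/

/-- If `M(u²) = 0` then `Re u ≤ 2` (compare `|eᵘ + e⁻ᵘ| ≥ eˣ - 1` with `2|e^{u/20} + e^{-u/20}| ≤ 4e^{x/20}`).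
[cite: Farmer2022, §4] -/
private theorem re_le_two_of_coshSqrtMix_sq_eq_zero {u : ℂ} (h : coshSqrtMix (u ^ 2) = 0) : u.re ≤ 2 := by
  by_contra hx
  push Not at hx
  rw [coshSqrtMix_sq] at h
  -- `e^u + e^{-u} = -2 (e^{u/20} + e^{-u/20})`
  have hE : Complex.exp u + Complex.exp (-u) = -(2 * (Complex.exp (u / 20) + Complex.exp (-(u / 20)))) := by
    rw [← Complex.two_cosh, ← Complex.two_cosh]; linear_combination 2 * h
  have hn := congrArg (fun t : ℂ ↦ ‖t‖) hE
  simp only [norm_neg, norm_mul, Complex.norm_two] at hn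
  -- lower bound for the left side, upper bound for the right side
  have hl : Real.exp u.re - Real.exp (-u.re) ≤ ‖Complex.exp u + Complex.exp (-u)‖ := by
    have h1 := norm_sub_norm_le (Complex.exp u) (-Complex.exp (-u))
    rw [sub_neg_eq_add, norm_neg, Complex.norm_exp, Complex.norm_exp, Complex.neg_re] at h1
    exact h1
  have hr : ‖Complex.exp (u / 20) + Complex.exp (-(u / 20))‖ ≤ Real.exp (u.re / 20) + Real.exp (-(u.re / 20)) := by
    refine (norm_add_le _ _).trans ?_
    rw [Complex.norm_exp, Complex.norm_exp, Complex.neg_re, Complex.div_ofNat_re]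
  set p : ℝ := Real.exp (u.re / 20) with hp
  have hp1 : (11 : ℝ) / 10 ≤ p := by
    have := Real.add_one_le_exp (u.re / 20)
    rw [hp]; linarith
  have hp0 : 0 < p := Real.exp_pos _
  have hexp : Real.exp u.re = p ^ 20 := by
    rw [hp, ← Real.exp_nat_mul]; congr 1; push_cast; ring
  have hm1 : Real.exp (-u.re) ≤ 1 := by rw [Real.exp_le_one_iff]; linarith
  have hm2 : Real.exp (-(u.re / 20)) ≤ 1 := by rw [Real.exp_le_one_iff]; linarith
  have key : p ^ 20 - 1 ≤ 2 * (p + 1) := by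
    have : Real.exp u.re - Real.exp (-u.re) ≤ 2 * (Real.exp (u.re / 20) + Real.exp (-(u.re / 20))) := by
      linarith
    rw [hexp] at this
    linarith
  have h19 : ((11 : ℝ) / 10) ^ 19 ≤ p ^ 19 := pow_le_pow_left₀ (by norm_num) hp1 19
  have hnum : (6 : ℝ) < ((11 : ℝ) / 10) ^ 19 := by norm_num
  nlinarith

/-- Every zero of `M` is `u²` with `|Re u| ≤ 2`. [cite: Farmer2022, §4] -/
theorem exists_sq_eq_abs_re_le_of_coshSqrtMix_eq_zero {w : ℂ} (hw : coshSqrtMix w = 0) :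
    ∃ u : ℂ, u ^ 2 = w ∧ |u.re| ≤ 2 := by
  obtain ⟨u, rfl⟩ := exists_sq_eq w
  refine ⟨u, rfl, abs_le.2 ⟨?_, re_le_two_of_coshSqrtMix_sq_eq_zero hw⟩⟩
  have h := re_le_two_of_coshSqrtMix_sq_eq_zero (u := -u) (by rw [neg_sq]; exact hw)
  rw [Complex.neg_re] at h
  linarith

/-! ### Jensen polynomials of `M` and the packaged caveat witness -/

/-- **Every `J^{d,n}(M)` with `n ≥ 1` is hyperbolic** (`M'` is genus-zero Laguerre–Pólya).
[cite: Farmer2022, §4] -/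
theorem splits_jensenPoly_coshSqrtMix {n : ℕ} (hn : 1 ≤ n) (d : ℕ) :
    (jensenPoly (taylorCoeffSeq coshSqrtMix) d n).Splits := by
  obtain ⟨m, rfl⟩ := Nat.exists_eq_add_of_le' hn
  rw [jensenPoly_taylorCoeffSeq_succ]
  exact Literature.Analysis.Complex.PolyaSchur.splits_jensenPoly_taylor_of_zeros_real
    isEntireOfOrderLtOne_deriv_coshSqrtMix (by rw [deriv_coshSqrtMix_zero, Complex.ofReal_im])
    (by rw [deriv_coshSqrtMix_zero, Complex.ofReal_ne_zero]; norm_num)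
    (fun w hw ↦ im_eq_zero_of_deriv_coshSqrtMix_eq_zero hw) d m

/-- The Taylor data of `M` is `EventuallyHyperbolic` (uniformly, `N(d) = 1`). [cite: Farmer2022, §4] -/
theorem eventuallyHyperbolic_coshSqrtMix : EventuallyHyperbolic (taylorCoeffSeq coshSqrtMix) :=
  fun d _ ↦ ⟨1, fun _ hn ↦ splits_jensenPoly_coshSqrtMix hn d⟩

/-- **Some `J^{d,0}(M)` is NOT hyperbolic** (Pólya–Schur converse: `M` has a non-real zero).
[cite: Farmer2022, §4] -/
theorem exists_not_splits_jensenPoly_coshSqrtMix_zero :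
    ∃ d : ℕ, ¬ (jensenPoly (taylorCoeffSeq coshSqrtMix) d 0).Splits := by
  by_contra h
  push Not at h
  have him := im_eq_zero_of_forall_splits_taylorCoeffSeq differentiable_coshSqrtMix coshSqrtMix_conj
    (by rw [coshSqrtMix_zero]; norm_num) h (coshSqrtMix_uSeq_sq 0)
  exact im_uSeq_sq_ne 0 him

/-- … but not `AllHyperbolic`. [cite: Farmer2022, §4] -/
theorem not_allHyperbolic_coshSqrtMix : ¬ AllHyperbolic (taylorCoeffSeq coshSqrtMix) := by
  obtain ⟨d, hd⟩ := exists_not_splits_jensenPoly_coshSqrtMix_zero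
  exact fun h ↦ hd (h d 0)

end CoshSqrtMix

open CoshSqrtMix

/-- **The scope caveat of `JensenPolynomialsSqrt` as a typed statement.** There is a real entire `G` of
order `< 1` with positive Taylor coefficients, `G'` of order `< 1` with ONLY REAL zeros (genus-zero
Laguerre–Pólya, so `J^{d,n}(G)` is hyperbolic for every `d` and every `n ≥ 1`, and `EventuallyHyperbolic`
holds), all zeros `u²` with `|Re u| ≤ 2`, INFINITELY MANY REAL zeros AND INFINITELY MANY NON-REAL zeros —
so `AllHyperbolic` fails. (The tree's witness `cosh 2 + cosh √w` has no real zero at all.)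
[cite: Farmer2022, §4] -/
def JensenPolynomialsSqrtMixed : Prop :=
  ∃ G : ℂ → ℂ, IsEntireOfOrderLtOne G ∧
    (∀ k : ℕ, (iteratedDeriv k G 0).im = 0 ∧ 0 < (iteratedDeriv k G 0).re) ∧
    IsEntireOfOrderLtOne (deriv G) ∧ (∀ w : ℂ, deriv G w = 0 → w.im = 0) ∧
    (∃ a : ℝ, ∀ w : ℂ, G w = 0 → ∃ u : ℂ, u ^ 2 = w ∧ |u.re| ≤ a) ∧
    {w : ℂ | G w = 0 ∧ w.im = 0}.Infinite ∧ {w : ℂ | G w = 0 ∧ w.im ≠ 0}.Infinite ∧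
    (∀ d n : ℕ, 1 ≤ n → (jensenPoly (taylorCoeffSeq G) d n).Splits) ∧
    EventuallyHyperbolic (taylorCoeffSeq G) ∧ ¬ AllHyperbolic (taylorCoeffSeq G)

/-- **It holds**, witnessed by `M(w) = cosh √w + 2 cosh (√w/20)`. [cite: Farmer2022, §4] -/
theorem JensenPolynomialsSqrtMixed_holds : JensenPolynomialsSqrtMixed := by
  refine ⟨coshSqrtMix, isEntireOfOrderLtOne_coshSqrtMix, fun k ↦ ⟨im_iteratedDeriv_coshSqrtMix k, ?_⟩,
    isEntireOfOrderLtOne_deriv_coshSqrtMix, fun w hw ↦ im_eq_zero_of_deriv_coshSqrtMix_eq_zero hw,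
    ⟨2, fun w hw ↦ exists_sq_eq_abs_re_le_of_coshSqrtMix_eq_zero hw⟩,
    coshSqrtMix_real_zeros_infinite, coshSqrtMix_nonreal_zeros_infinite,
    fun d n hn ↦ splits_jensenPoly_coshSqrtMix hn d, eventuallyHyperbolic_coshSqrtMix,
    not_allHyperbolic_coshSqrtMix⟩
  have := taylorCoeffSeq_coshSqrtMix_pos k
  rwa [taylorCoeffSeq] at this

end Literature.Barriers.RiemannHypothesis

end
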